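/-
Copyright (c) 2026 the pub-hodgecm-mathlib formalisation cell (harness21).  Prover seat hodgecm-mathlib-K2E4-p11 (g5), Track B ∕ K2-LIT, h413 =
`stmt-HodgeConjecture-24833`, line `K2_E1_TraceFormulaBeta`, campaign «EIS-R7-BL-SPH-2», P5c FILE A (dealer K2E1-plan (g5) 2026-09-04T09:11:29Z ∕ 09:17:24Z; census ∕ heads 09:25Z):
a SMOOTH, non-negative, BI-`K_GL`-INVARIANT `GL_n(𝔸_K)` TEST FUNCTION equal to `1` at `1`, with archimedean support in a prescribed defect tube around `K_∞` — the `GL`-side of P5c.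
-/
import Literature.NumberTheory.Automorphic.AutomorphicRepsGLCuspidalL2Step1Bump            -- ★ `hsQ` (Hilbert–Schmidt form): `contDiff_hsQ`, `continuous_hsQ`, `hsQ_nonneg`, `eq_zero_of_hsQ_eq_zero`, `hsQ_smul`, coercivity
import Literature.NumberTheory.Automorphic.HarishChandraConvolutionAdelic                   -- ★ `adelicWeight`, `isTestFunctionGL_adelicWeight`
import Literature.NumberTheory.Automorphic.UnitaryGroupBorelSiegelSet                       -- ★ `mem_standardMaximalCompactGL_iff_toMixed_sndHom`, `Kinf`
import HarnessLib

/-!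
# h413 ∕ Track B «K2-LIT», «EIS-R7-BL-SPH-2» P5c FILE A — `K2E1SphericalTestFunctionGL`: the spherical defect `Q(xᴴ − x⁻¹)` on `GL_n(K ⊗ ℝ)` and the smooth bi-`K_GL`-invariant
# test function `η(g) = φ(Q(g_∞ᴴ − g_∞⁻¹))·𝟙[g_f ∈ GL_n(𝒪̂_K)]` on `GL_n(𝔸_K)`

Cell `pub/hodgecm-mathlib`, crux H413 = `stmt-HodgeConjecture-24833`, route `HCCMUnconditional`; dealer K2E1-plan (g5) («P5c: `∃ η, IsTestFunctionGL 2 L η ∧ bi-K_U-invariant ∧ 0 ≤ η ∧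
η̂ z₀ ≠ 0`»; FILE B `K2E1SphericalHeckeSmoothTestFunctionU2` pulls this back to `U(J_N)(𝔸_F)` and proves `Re η̂(z₀) > 0`).  THEOREMS ONLY (no `def`, no `instance`, no `notation`, no
named-fact hypothesis, no `sorry`); lane `--kind proof --supports stmt-HodgeConjecture-24833 --as helper` (count-neutral).
THE MATHEMATICS.  With the Hilbert–Schmidt form `Q(z) = Re tr(zᴴz)` on `M_n(K ⊗ ℝ)` (★ `hsQ`), the SPHERICAL DEFECT `D(x) := Q(xᴴ − x⁻¹)` of `x ∈ GL_n(K ⊗ ℝ)` is smooth, bi-`K_∞`-invariant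
(`K_∞ = Kinf = U(n, K ⊗ ℝ)`, ★ `Kinf_eq_unitarySubgroupGL`: `(kx)ᴴ − (kx)⁻¹ = (xᴴ − x⁻¹)kᴴ`, `(xk)ᴴ − (xk)⁻¹ = kᴴ(xᴴ − x⁻¹)`), and satisfies the KEY IDENTITY
**`Q(xᴴ − x⁻¹) = Q(x) + Q(x⁻¹) − 2Q(1)`**; hence `{D ≤ r}` is COMPACT (it bounds `x` and `x⁻¹`; Mathlib `Units.isClosedEmbedding_embedProduct`, `M_n(K ⊗ ℝ)` proper) and
`D(x) = 0 ⟹ xᴴx = 1`, i.e. `x ∈ K_∞`.  The test function `η(g) = φ(D(g_∞))·𝟙[g_f ∈ GL_n(𝒪̂_K)]` (★ `adelicWeight`, `φ` a `ContDiffBump` at `0`; written inline, no `def`) is a `GL_n(𝔸_K)`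
test function (★ `isTestFunctionGL_adelicWeight`, ★ `isOpen_glFiniteIntegralLevel`, ★ `isCompact_glFiniteIntegralLevel_holds`), `≥ 0`, `= 1` at `1`, and bi-invariant under
`K_GL = K_∞·GL_n(𝒪̂_K)` (★ `mem_standardMaximalCompactGL_iff_toMixed_sndHom`).  (Garrett §6.3∕§7.3: `C_c^∞(G_𝔸)` and its pure tensors; Knapp I §1: `U(n)` and the Hilbert–Schmidt norm.)
* §1 `hsQ_mul_left_of ∕ hsQ_mul_right_of`, **`hsQ_conjTranspose_sub_inv`** (key identity), `star_mul_self_eq_one_of_hsQ_defect_eq_zero`, `coe_inv_eq_conjTranspose`, `hsQ_defect_mul_left ∕ _right`.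
* §2 `exists_norm_le_of_hsQ_le`, `continuous_hsQ_defect`, `isCompact_setOf_hsQ_defect_le`, `bump_hsQ_defect_one`, `hsQ_defect_lt_of_bump_ne_zero`, `continuous_bump_hsQ_defect`,
  `hasCompactSupport_bump_hsQ_defect`, `contDiff_bump_hsQ_defect_mul_expGL`, `bump_hsQ_defect_mul_mul` (bi-`K_∞`).
* §3 `sphericalWeight_apply`, **`isTestFunctionGL_sphericalWeight`**, `sphericalWeight_nonneg`, `sphericalWeight_one`, **`sphericalWeight_mul_mul`** (bi-`K_GL`).
HONEST LABEL.  Count-neutral helper; proves no printed statement; HC_CM is proved only modulo the 7 printed citations (2 remaining named inputs: hLiu418 = `stmt-HodgeConjecture-24832`,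
h413 = `stmt-HodgeConjecture-24833`) until rung 0 closes.

## References
* [Garrett2018] P. Garrett, *Modern Analysis of Automorphic Forms by Example* (2018), §6.3, §7.3 (`C_c^∞(G_𝔸)`, pure tensors `f_∞ ⊗ f_fin`).
* [Knapp1986] A. W. Knapp, *Representation Theory of Semisimple Groups* (1986), Ch. I §1 (`U(n)`, the Hilbert–Schmidt norm).
* [MoeglinWaldspurger1995] C. Mœglin, J.-L. Waldspurger, *Spectral Decomposition and Eisenstein Series* (1995), II.1.2 (bi-`K`-invariant test functions).
-/

set_option autoImplicit false
set_option linter.dupNamespace false  -- the mandated namespace repeats the summit's segment (`HodgeConjecture.HodgeConjecture`)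

noncomputable section

open NumberField NumberField.mixedEmbedding IsDedekindDomain Set Filter Topology
open scoped NNReal MatrixGroups Matrix ContDiff Classical Pointwise
open Literature.NumberTheory Literature.NumberTheory.Automorphic Literature.NumberTheory.Automorphic.UnitaryGroup

namespace Summit.HodgeConjecture.HodgeConjecture.Cruxes.H413.K2E1SphericalTestFunctionGL


/-! ## §1 The Hilbert–Schmidt form under unitary factors; the key identity for the spherical defect `Q(xᴴ − x⁻¹)` -/

section HS

variable {n : ℕ} {K : Type} [Field K] [NumberField K]

/-- `Q(u z) = Q(z)` for `uᴴ u = 1` (`(uz)ᴴ(uz) = zᴴ uᴴ u z`). [cite: Knapp1986, Ch. I §1] -/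
theorem hsQ_mul_left_of {u : Matrix (Fin n) (Fin n) (mixedSpace K)} (hu : uᴴ * u = 1) (z : Matrix (Fin n) (Fin n) (mixedSpace K)) :
    hsQ (u * z) = hsQ z := by
  unfold hsQ
  rw [Matrix.conjTranspose_mul, Matrix.mul_assoc, ← Matrix.mul_assoc uᴴ u z, hu, Matrix.one_mul]

/-- `Q(z u) = Q(z)` for `u uᴴ = 1` (`tr(uᴴ zᴴ z u) = tr(u uᴴ zᴴ z)`). [cite: Knapp1986, Ch. I §1] -/
theorem hsQ_mul_right_of {u : Matrix (Fin n) (Fin n) (mixedSpace K)} (hu : u * uᴴ = 1) (z : Matrix (Fin n) (Fin n) (mixedSpace K)) :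
    hsQ (z * u) = hsQ z := by
  unfold hsQ
  rw [Matrix.conjTranspose_mul, show uᴴ * zᴴ * (z * u) = uᴴ * (zᴴ * z) * u by simp only [Matrix.mul_assoc], Matrix.trace_mul_cycle, hu, Matrix.one_mul]

/-- **THE KEY IDENTITY `Q(xᴴ − x⁻¹) = Q(x) + Q(x⁻¹) − 2Q(1)`** on `GL_n(K ⊗ ℝ)`: `(xᴴ − x⁻¹)ᴴ(xᴴ − x⁻¹) = x xᴴ − 1 − 1 + x⁻ᴴ x⁻¹` and `tr(x xᴴ) = tr(xᴴ x)`.  Hence the defect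
`Q(xᴴ − x⁻¹)` controls `Q(x)` and `Q(x⁻¹)`, and vanishes exactly on the unitary group. [cite: Knapp1986, Ch. I §1] -/
theorem hsQ_conjTranspose_sub_inv (x : GL (Fin n) (mixedSpace K)) :
    hsQ ((x : Matrix (Fin n) (Fin n) (mixedSpace K))ᴴ - ((x⁻¹ : GL (Fin n) (mixedSpace K)) : Matrix (Fin n) (Fin n) (mixedSpace K))) =
      hsQ (x : Matrix (Fin n) (Fin n) (mixedSpace K)) + hsQ ((x⁻¹ : GL (Fin n) (mixedSpace K)) : Matrix (Fin n) (Fin n) (mixedSpace K)) -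
        2 * hsQ (1 : Matrix (Fin n) (Fin n) (mixedSpace K)) := by
  set a : Matrix (Fin n) (Fin n) (mixedSpace K) := (x : Matrix (Fin n) (Fin n) (mixedSpace K)) with ha
  set b : Matrix (Fin n) (Fin n) (mixedSpace K) := ((x⁻¹ : GL (Fin n) (mixedSpace K)) : Matrix (Fin n) (Fin n) (mixedSpace K)) with hb
  have hab : a * b = 1 := by rw [ha, hb, ← Units.val_mul, mul_inv_cancel, Units.val_one]
  have hexp : (aᴴ - b)ᴴ * (aᴴ - b) = a * aᴴ - 1 - 1 + bᴴ * b := by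
    rw [Matrix.conjTranspose_sub, Matrix.conjTranspose_conjTranspose, Matrix.sub_mul, Matrix.mul_sub, Matrix.mul_sub, hab, ← Matrix.conjTranspose_mul, hab,
      Matrix.conjTranspose_one]
    abel
  unfold hsQ
  rw [hexp, Matrix.trace_add, Matrix.trace_sub, Matrix.trace_sub, Matrix.trace_mul_comm a aᴴ, map_add, map_sub, map_sub, Matrix.conjTranspose_one, Matrix.one_mul]
  ring

/-- **`Q(xᴴ − x⁻¹) = 0 ⟹ xᴴ x = 1`** (so `x ∈ K_∞ = U(n, K ⊗ ℝ)`, ★ `mem_unitarySubgroupGL_iff`). [cite: Knapp1986, Ch. I §1] -/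
theorem star_mul_self_eq_one_of_hsQ_defect_eq_zero {x : GL (Fin n) (mixedSpace K)}
    (h : hsQ ((x : Matrix (Fin n) (Fin n) (mixedSpace K))ᴴ - ((x⁻¹ : GL (Fin n) (mixedSpace K)) : Matrix (Fin n) (Fin n) (mixedSpace K))) = 0) :
    star (x : Matrix (Fin n) (Fin n) (mixedSpace K)) * x = 1 := by
  have h0 := eq_zero_of_hsQ_eq_zero h
  rw [sub_eq_zero] at h0
  rw [Matrix.star_eq_conjTranspose, h0, ← Units.val_mul, inv_mul_cancel, Units.val_one]

omit [NumberField K] in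
/-- For unitary `k` (`kᴴ k = 1`), the inverse is the conjugate transpose: `(k⁻¹ : M) = kᴴ`. [cite: Knapp1986, Ch. I §1] -/
theorem coe_inv_eq_conjTranspose {k : GL (Fin n) (mixedSpace K)} (hk : star (k : Matrix (Fin n) (Fin n) (mixedSpace K)) * k = 1) :
    ((k⁻¹ : GL (Fin n) (mixedSpace K)) : Matrix (Fin n) (Fin n) (mixedSpace K)) = (k : Matrix (Fin n) (Fin n) (mixedSpace K))ᴴ := by
  rw [Matrix.star_eq_conjTranspose] at hk
  rw [Matrix.coe_units_inv]
  exact Matrix.inv_eq_left_inv hk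

/-- **The defect is LEFT-`K_∞`-invariant**: `Q((kx)ᴴ − (kx)⁻¹) = Q(xᴴ − x⁻¹)` for `kᴴ k = 1` (`(kx)ᴴ − (kx)⁻¹ = (xᴴ − x⁻¹) kᴴ`). [cite: Knapp1986, Ch. I §1] -/
theorem hsQ_defect_mul_left {k : GL (Fin n) (mixedSpace K)} (hk : star (k : Matrix (Fin n) (Fin n) (mixedSpace K)) * k = 1) (x : GL (Fin n) (mixedSpace K)) :
    hsQ (((k * x : GL (Fin n) (mixedSpace K)) : Matrix (Fin n) (Fin n) (mixedSpace K))ᴴ - (((k * x)⁻¹ : GL (Fin n) (mixedSpace K)) : Matrix (Fin n) (Fin n) (mixedSpace K))) =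
      hsQ ((x : Matrix (Fin n) (Fin n) (mixedSpace K))ᴴ - ((x⁻¹ : GL (Fin n) (mixedSpace K)) : Matrix (Fin n) (Fin n) (mixedSpace K))) := by
  have hkk : (k : Matrix (Fin n) (Fin n) (mixedSpace K))ᴴ * (k : Matrix (Fin n) (Fin n) (mixedSpace K)) = 1 := by
    rw [← Matrix.star_eq_conjTranspose]; exact hk
  rw [Units.val_mul, Matrix.conjTranspose_mul, mul_inv_rev, Units.val_mul, coe_inv_eq_conjTranspose hk, ← Matrix.sub_mul,
    hsQ_mul_right_of (by rw [Matrix.conjTranspose_conjTranspose]; exact hkk)]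

/-- **The defect is RIGHT-`K_∞`-invariant**: `Q((xk)ᴴ − (xk)⁻¹) = Q(xᴴ − x⁻¹)` for `kᴴ k = 1` (`(xk)ᴴ − (xk)⁻¹ = kᴴ (xᴴ − x⁻¹)`, `k kᴴ = 1`). [cite: Knapp1986, Ch. I §1] -/
theorem hsQ_defect_mul_right {k : GL (Fin n) (mixedSpace K)} (hk : star (k : Matrix (Fin n) (Fin n) (mixedSpace K)) * k = 1) (x : GL (Fin n) (mixedSpace K)) :
    hsQ (((x * k : GL (Fin n) (mixedSpace K)) : Matrix (Fin n) (Fin n) (mixedSpace K))ᴴ - (((x * k)⁻¹ : GL (Fin n) (mixedSpace K)) : Matrix (Fin n) (Fin n) (mixedSpace K))) =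
      hsQ ((x : Matrix (Fin n) (Fin n) (mixedSpace K))ᴴ - ((x⁻¹ : GL (Fin n) (mixedSpace K)) : Matrix (Fin n) (Fin n) (mixedSpace K))) := by
  have hkk : (k : Matrix (Fin n) (Fin n) (mixedSpace K))ᴴ * (k : Matrix (Fin n) (Fin n) (mixedSpace K)) = 1 := by
    rw [← Matrix.star_eq_conjTranspose]; exact hk
  have hkk' : (k : Matrix (Fin n) (Fin n) (mixedSpace K)) * (k : Matrix (Fin n) (Fin n) (mixedSpace K))ᴴ = 1 := mul_eq_one_comm.1 hkk
  rw [Units.val_mul, Matrix.conjTranspose_mul, mul_inv_rev, Units.val_mul, coe_inv_eq_conjTranspose hk, ← Matrix.mul_sub,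
    hsQ_mul_left_of (by rw [Matrix.conjTranspose_conjTranspose]; exact hkk')]

end HS

/-! ## §2 The archimedean spherical bump `x ↦ φ(Q(xᴴ − x⁻¹))` on `GL_n(K ⊗ ℝ)`: smooth, bi-`K_∞`-invariant, compactly supported -/

section Bump

variable {n : ℕ} {K : Type} [Field K] [NumberField K]

-- the scoped operator norm on `𝔤𝔩_n(K_∞)` (the one through which `IsArchSmooth` is defined), as in ★ `AutomorphicRepsGLCuspidalL2Step1Bump`
open scoped Matrix.Norms.Operator

set_option backward.isDefEq.respectTransparency false in
/-- **Quantitative coercivity**: `Q(z) ≤ R ⟹ ‖z‖ ≤ C(R)` (★ `exists_hsQ_lt_imp_norm_lt` at `ε = 1`, rescaled by `hsQ_smul`). [folklore] -/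
theorem exists_norm_le_of_hsQ_le (R : ℝ) : ∃ C : ℝ, ∀ z : Matrix (Fin n) (Fin n) (mixedSpace K), hsQ z ≤ R → ‖z‖ ≤ C := by
  obtain ⟨ρ, hρ, hρ1⟩ := exists_hsQ_lt_imp_norm_lt (n := n) (K := K) one_pos
  rcases le_or_gt R 0 with hR | hR
  · refine ⟨1, fun z hz => ?_⟩
    have h0 : hsQ z = 0 := le_antisymm (hz.trans hR) (hsQ_nonneg z)
    rw [eq_zero_of_hsQ_eq_zero h0, norm_zero]
    exact zero_le_one
  · -- `t² = ρ ∕ (2R)`: `Q(t z) = t² Q(z) ≤ ρ∕2 < ρ`, so `t‖z‖ < 1`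
    set t : ℝ := Real.sqrt (ρ / (2 * R)) with ht
    have ht0 : 0 < t := Real.sqrt_pos.2 (by positivity)
    have ht2 : t ^ 2 = ρ / (2 * R) := Real.sq_sqrt (by positivity)
    refine ⟨t⁻¹, fun z hz => ?_⟩
    have hQ : hsQ (t • z) < ρ := by
      rw [hsQ_smul, ht2]
      have h1 : ρ / (2 * R) * hsQ z ≤ ρ / (2 * R) * R := mul_le_mul_of_nonneg_left hz (by positivity)
      have h2 : ρ / (2 * R) * R = ρ / 2 := by field_simp
      linarith
    have h := hρ1 _ hQ
    rw [_root_.norm_smul, Real.norm_of_nonneg ht0.le] at h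
    rw [← one_div, le_div_iff₀ ht0, mul_comm]
    exact h.le

set_option backward.isDefEq.respectTransparency false in
/-- The defect `x ↦ Q(xᴴ − x⁻¹)` is continuous on `GL_n(K ⊗ ℝ)`. [folklore] -/
theorem continuous_hsQ_defect :
    Continuous fun x : GL (Fin n) (mixedSpace K) => hsQ ((x : Matrix (Fin n) (Fin n) (mixedSpace K))ᴴ - ((x⁻¹ : GL (Fin n) (mixedSpace K)) : Matrix (Fin n) (Fin n) (mixedSpace K))) :=
  continuous_hsQ.comp (Units.continuous_val.matrix_conjTranspose.sub Units.continuous_coe_inv)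

set_option backward.isDefEq.respectTransparency false in
/-- **`{x : Q(xᴴ − x⁻¹) ≤ r}` IS COMPACT in `GL_n(K ⊗ ℝ)`**: by the key identity it bounds `‖x‖` and `‖x⁻¹‖` (§2 coercivity), so its image under the closed embedding `x ↦ (x, x⁻¹)` into
`M × Mᵐᵒᵖ` (Mathlib `Units.isClosedEmbedding_embedProduct`) is a closed subset of a product of closed balls (`M_n(K ⊗ ℝ)` is proper). [folklore] -/
theorem isCompact_setOf_hsQ_defect_le (r : ℝ) :
    IsCompact {x : GL (Fin n) (mixedSpace K) | hsQ ((x : Matrix (Fin n) (Fin n) (mixedSpace K))ᴴ - ((x⁻¹ : GL (Fin n) (mixedSpace K)) : Matrix (Fin n) (Fin n) (mixedSpace K))) ≤ r} := by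
  haveI : FiniteDimensional ℝ (Matrix (Fin n) (Fin n) (mixedSpace K)) := finiteDimensional_matrix_mixedSpace
  haveI : ProperSpace (Matrix (Fin n) (Fin n) (mixedSpace K)) := FiniteDimensional.proper ℝ _
  obtain ⟨C, hC⟩ := exists_norm_le_of_hsQ_le (n := n) (K := K) (r + 2 * hsQ (1 : Matrix (Fin n) (Fin n) (mixedSpace K)))
  set S : Set (GL (Fin n) (mixedSpace K)) := {x | hsQ ((x : Matrix (Fin n) (Fin n) (mixedSpace K))ᴴ - ((x⁻¹ : GL (Fin n) (mixedSpace K)) : Matrix (Fin n) (Fin n) (mixedSpace K))) ≤ r} with hS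
  have hSc : IsClosed S := isClosed_le continuous_hsQ_defect continuous_const
  have hbd : ∀ x ∈ S, ‖(x : Matrix (Fin n) (Fin n) (mixedSpace K))‖ ≤ C ∧ ‖((x⁻¹ : GL (Fin n) (mixedSpace K)) : Matrix (Fin n) (Fin n) (mixedSpace K))‖ ≤ C := by
    intro x hx
    have hid := hsQ_conjTranspose_sub_inv x
    have h1 := hsQ_nonneg (x : Matrix (Fin n) (Fin n) (mixedSpace K))
    have h2 := hsQ_nonneg ((x⁻¹ : GL (Fin n) (mixedSpace K)) : Matrix (Fin n) (Fin n) (mixedSpace K))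
    have hx' : hsQ ((x : Matrix (Fin n) (Fin n) (mixedSpace K))ᴴ - ((x⁻¹ : GL (Fin n) (mixedSpace K)) : Matrix (Fin n) (Fin n) (mixedSpace K))) ≤ r := hx
    exact ⟨hC _ (by linarith), hC _ (by linarith)⟩
  set B : Set (Matrix (Fin n) (Fin n) (mixedSpace K) × (Matrix (Fin n) (Fin n) (mixedSpace K))ᵐᵒᵖ) :=
    Metric.closedBall 0 C ×ˢ (MulOpposite.op '' Metric.closedBall 0 C) with hB
  have hBc : IsCompact B := (isCompact_closedBall _ _).prod ((isCompact_closedBall _ _).image MulOpposite.continuous_op)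
  have hsub : Units.embedProduct (Matrix (Fin n) (Fin n) (mixedSpace K)) '' S ⊆ B := by
    rintro _ ⟨x, hx, rfl⟩
    obtain ⟨h1, h2⟩ := hbd x hx
    refine ⟨?_, ?_⟩
    · show (x : Matrix (Fin n) (Fin n) (mixedSpace K)) ∈ Metric.closedBall 0 C
      rw [mem_closedBall_zero_iff]; exact h1
    · exact ⟨_, by rw [mem_closedBall_zero_iff]; exact h2, rfl⟩
  have hclosed : IsClosed (Units.embedProduct (Matrix (Fin n) (Fin n) (mixedSpace K)) '' S) := Units.isClosedEmbedding_embedProduct.isClosedMap _ hSc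
  exact Units.isEmbedding_embedProduct.isCompact_iff.2 (hBc.of_isClosed_subset hclosed hsub)

variable (φ : ContDiffBump (0 : ℝ))

/-- `φ(Q(xᴴ − x⁻¹)) ≥ 0`. [folklore] -/
theorem bump_hsQ_defect_nonneg (x : GL (Fin n) (mixedSpace K)) :
    0 ≤ φ (hsQ ((x : Matrix (Fin n) (Fin n) (mixedSpace K))ᴴ - ((x⁻¹ : GL (Fin n) (mixedSpace K)) : Matrix (Fin n) (Fin n) (mixedSpace K)))) :=
  φ.nonneg

/-- `φ(Q(1ᴴ − 1⁻¹)) = 1`. [folklore] -/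
theorem bump_hsQ_defect_one :
    φ (hsQ (((1 : GL (Fin n) (mixedSpace K)) : Matrix (Fin n) (Fin n) (mixedSpace K))ᴴ - (((1 : GL (Fin n) (mixedSpace K))⁻¹ : GL (Fin n) (mixedSpace K)) : Matrix (Fin n) (Fin n) (mixedSpace K)))) = 1 := by
  have h0 : hsQ (((1 : GL (Fin n) (mixedSpace K)) : Matrix (Fin n) (Fin n) (mixedSpace K))ᴴ - (((1 : GL (Fin n) (mixedSpace K))⁻¹ : GL (Fin n) (mixedSpace K)) : Matrix (Fin n) (Fin n) (mixedSpace K))) = 0 := by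
    rw [inv_one, Units.val_one, Matrix.conjTranspose_one, sub_self, hsQ_eq_sum]; simp
  rw [h0]
  exact φ.one_of_mem_closedBall (Metric.mem_closedBall_self φ.rIn_pos.le)

/-- Support control: `φ(Q(xᴴ − x⁻¹)) ≠ 0 ⟹ Q(xᴴ − x⁻¹) < φ.rOut`. [folklore] -/
theorem hsQ_defect_lt_of_bump_ne_zero {x : GL (Fin n) (mixedSpace K)}
    (hx : φ (hsQ ((x : Matrix (Fin n) (Fin n) (mixedSpace K))ᴴ - ((x⁻¹ : GL (Fin n) (mixedSpace K)) : Matrix (Fin n) (Fin n) (mixedSpace K)))) ≠ 0) :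
    hsQ ((x : Matrix (Fin n) (Fin n) (mixedSpace K))ᴴ - ((x⁻¹ : GL (Fin n) (mixedSpace K)) : Matrix (Fin n) (Fin n) (mixedSpace K))) < φ.rOut := by
  have h2 := φ.support_eq ▸ Function.mem_support.2 hx
  rw [Metric.mem_ball, Real.dist_eq, sub_zero] at h2
  exact lt_of_abs_lt h2

set_option backward.isDefEq.respectTransparency false in
/-- `x ↦ φ(Q(xᴴ − x⁻¹))` is continuous on `GL_n(K ⊗ ℝ)`. [folklore] -/
theorem continuous_bump_hsQ_defect :
    Continuous fun x : GL (Fin n) (mixedSpace K) => φ (hsQ ((x : Matrix (Fin n) (Fin n) (mixedSpace K))ᴴ - ((x⁻¹ : GL (Fin n) (mixedSpace K)) : Matrix (Fin n) (Fin n) (mixedSpace K)))) :=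
  φ.continuous.comp continuous_hsQ_defect

/-- `x ↦ φ(Q(xᴴ − x⁻¹))` has compact support (inside the compact `{Q(xᴴ − x⁻¹) ≤ φ.rOut}`). [folklore] -/
theorem hasCompactSupport_bump_hsQ_defect :
    HasCompactSupport fun x : GL (Fin n) (mixedSpace K) => φ (hsQ ((x : Matrix (Fin n) (Fin n) (mixedSpace K))ᴴ - ((x⁻¹ : GL (Fin n) (mixedSpace K)) : Matrix (Fin n) (Fin n) (mixedSpace K)))) :=
  HasCompactSupport.of_support_subset_isCompact (isCompact_setOf_hsQ_defect_le (n := n) (K := K) φ.rOut)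
    fun _ hx => (hsQ_defect_lt_of_bump_ne_zero φ (Function.mem_support.1 hx)).le

set_option backward.isDefEq.respectTransparency false in
/-- **Smoothness along the exponential chart**: `X ↦ φ(Q((x₀ e^X)ᴴ − (x₀ e^X)⁻¹))` is `C^∞` on `M_n(K ⊗ ℝ)` (`(x₀e^X)⁻¹ = e^{−X}x₀⁻¹`; `ᴴ` is real-linear; ★ `contDiff_hsQ`,
★ `contDiff_exp_matrix_mixedSpace`). [folklore] -/
theorem contDiff_bump_hsQ_defect_mul_expGL (x₀ : GL (Fin n) (mixedSpace K)) :
    ContDiff ℝ ∞ fun X : Matrix (Fin n) (Fin n) (mixedSpace K) =>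
      φ (hsQ (((x₀ * expGL X : GL (Fin n) (mixedSpace K)) : Matrix (Fin n) (Fin n) (mixedSpace K))ᴴ - (((x₀ * expGL X)⁻¹ : GL (Fin n) (mixedSpace K)) : Matrix (Fin n) (Fin n) (mixedSpace K)))) := by
  haveI : FiniteDimensional ℝ (Matrix (Fin n) (Fin n) (mixedSpace K)) := finiteDimensional_matrix_mixedSpace
  have hexp := contDiff_exp_matrix_mixedSpace (n := n) (K := K)
  let cT : Matrix (Fin n) (Fin n) (mixedSpace K) →ₗ[ℝ] Matrix (Fin n) (Fin n) (mixedSpace K) :=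
    { toFun := fun z => zᴴ
      map_add' := fun x y => Matrix.conjTranspose_add x y
      map_smul' := fun t x => by rw [Matrix.conjTranspose_smul, star_trivial]; rfl }
  have hcT : ContDiff ℝ ∞ fun z : Matrix (Fin n) (Fin n) (mixedSpace K) => zᴴ := (LinearMap.toContinuousLinearMap cT).contDiff
  have hfun : (fun X : Matrix (Fin n) (Fin n) (mixedSpace K) =>
      φ (hsQ (((x₀ * expGL X : GL (Fin n) (mixedSpace K)) : Matrix (Fin n) (Fin n) (mixedSpace K))ᴴ - (((x₀ * expGL X)⁻¹ : GL (Fin n) (mixedSpace K)) : Matrix (Fin n) (Fin n) (mixedSpace K))))) =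
      fun X => φ (hsQ (((x₀ : Matrix (Fin n) (Fin n) (mixedSpace K)) * NormedSpace.exp X)ᴴ -
        NormedSpace.exp (-X) * ((x₀⁻¹ : GL (Fin n) (mixedSpace K)) : Matrix (Fin n) (Fin n) (mixedSpace K)))) := by
    funext X
    rw [Units.val_mul, coe_expGL, mul_inv_rev, Units.val_mul, ← expGL_neg, coe_expGL]
  rw [hfun]
  refine (φ.contDiff.comp contDiff_hsQ).comp ((hcT.comp (contDiff_const.mul hexp)).sub ((hexp.comp contDiff_neg).mul contDiff_const))

/-- **Bi-`K_∞`-invariance of the bump**: `φ(D(k₁ x k₂)) = φ(D(x))` for `k₁, k₂ ∈ K_∞ = Kinf n K`. [cite: Knapp1986, Ch. I §1] -/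
theorem bump_hsQ_defect_mul_mul {k₁ k₂ : GL (Fin n) (mixedSpace K)} (hk₁ : k₁ ∈ Kinf n K) (hk₂ : k₂ ∈ Kinf n K) (x : GL (Fin n) (mixedSpace K)) :
    φ (hsQ (((k₁ * x * k₂ : GL (Fin n) (mixedSpace K)) : Matrix (Fin n) (Fin n) (mixedSpace K))ᴴ - (((k₁ * x * k₂)⁻¹ : GL (Fin n) (mixedSpace K)) : Matrix (Fin n) (Fin n) (mixedSpace K)))) =
      φ (hsQ ((x : Matrix (Fin n) (Fin n) (mixedSpace K))ᴴ - ((x⁻¹ : GL (Fin n) (mixedSpace K)) : Matrix (Fin n) (Fin n) (mixedSpace K)))) := by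
  rw [Kinf_eq_unitarySubgroupGL, mem_unitarySubgroupGL_iff] at hk₁ hk₂
  rw [hsQ_defect_mul_right hk₂, hsQ_defect_mul_left hk₁]

end Bump

/-! ## §3 The adelic spherical test function `η(g) = φ(D(g_∞))·𝟙[g_f ∈ GL_n(𝒪̂_K)]` on `GL_n(𝔸_K)` -/

section Adelic

variable {n : ℕ} {K : Type} [Field K] [NumberField K] (φ : ContDiffBump (0 : ℝ))

/-- `η(g) = φ(D(g_∞)) · 𝟙[g_f ∈ GL_n(𝒪̂_K)]` (★ `adelicWeight_apply`, ★ `mem_levelSlab_iff`). [cite: Garrett2018, §7.3] -/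
theorem sphericalWeight_apply (g : GL (Fin n) (AdeleRing (𝓞 K) K)) :
    adelicWeight (glFiniteIntegralLevel n K) (fun x : GL (Fin n) (mixedSpace K) => φ (hsQ ((x : Matrix (Fin n) (Fin n) (mixedSpace K))ᴴ - ((x⁻¹ : GL (Fin n) (mixedSpace K)) : Matrix (Fin n) (Fin n) (mixedSpace K))))) g =
      φ (hsQ (((GLn.toMixed n K g : GL (Fin n) (mixedSpace K)) : Matrix (Fin n) (Fin n) (mixedSpace K))ᴴ - (((GLn.toMixed n K g)⁻¹ : GL (Fin n) (mixedSpace K)) : Matrix (Fin n) (Fin n) (mixedSpace K)))) *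
        (if GLn.sndHom n K g ∈ glFiniteIntegralLevel n K then 1 else 0) := by
  rw [adelicWeight_apply, Set.indicator_apply]
  rfl

set_option backward.isDefEq.respectTransparency false in
open scoped Matrix.Norms.Operator in
/-- **`η` IS A `GL_n(𝔸_K)` TEST FUNCTION** (★ `isTestFunctionGL_adelicWeight` with the compact open level `GL_n(𝒪̂_K)` — ★ `isOpen_glFiniteIntegralLevel`, ★ `isCompact_glFiniteIntegralLevel_holds` — and §2).
[cite: Garrett2018, §6.3, §7.3] -/
theorem isTestFunctionGL_sphericalWeight :
    IsTestFunctionGL n K (adelicWeight (glFiniteIntegralLevel n K)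
      (fun x : GL (Fin n) (mixedSpace K) => φ (hsQ ((x : Matrix (Fin n) (Fin n) (mixedSpace K))ᴴ - ((x⁻¹ : GL (Fin n) (mixedSpace K)) : Matrix (Fin n) (Fin n) (mixedSpace K)))))) := by
  -- Mathlib idiom (Mathlib/Algebra/Lie/OfAssociative.lean), kept LOCAL to this proof: the Lie ring structure on `M_n(K ⊗ ℝ)` through which `(archGroupGL n K).lie` is stated
  letI : LieRing (Matrix (Fin n) (Fin n) (mixedSpace K)) := LieRing.ofAssociativeRing
  have hval : ContDiff ℝ ∞ fun X : (archGroupGL n K).lie.toSubmodule => (X : Matrix (Fin n) (Fin n) (mixedSpace K)) :=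
    (archGroupGL n K).lie.toSubmodule.subtypeL.contDiff
  exact isTestFunctionGL_adelicWeight (isOpen_glFiniteIntegralLevel n K) (isCompact_glFiniteIntegralLevel_holds n K) (continuous_bump_hsQ_defect φ)
    (hasCompactSupport_bump_hsQ_defect φ) fun u => (contDiff_bump_hsQ_defect_mul_expGL φ u).comp hval

/-- `η ≥ 0`. [folklore] -/
theorem sphericalWeight_nonneg (g : GL (Fin n) (AdeleRing (𝓞 K) K)) :
    0 ≤ adelicWeight (glFiniteIntegralLevel n K) (fun x : GL (Fin n) (mixedSpace K) => φ (hsQ ((x : Matrix (Fin n) (Fin n) (mixedSpace K))ᴴ - ((x⁻¹ : GL (Fin n) (mixedSpace K)) : Matrix (Fin n) (Fin n) (mixedSpace K))))) g := by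
  rw [sphericalWeight_apply]
  exact mul_nonneg φ.nonneg (by split_ifs <;> norm_num)

/-- `η(1) = 1`. [folklore] -/
theorem sphericalWeight_one :
    adelicWeight (glFiniteIntegralLevel n K) (fun x : GL (Fin n) (mixedSpace K) => φ (hsQ ((x : Matrix (Fin n) (Fin n) (mixedSpace K))ᴴ - ((x⁻¹ : GL (Fin n) (mixedSpace K)) : Matrix (Fin n) (Fin n) (mixedSpace K))))) (1 : GL (Fin n) (AdeleRing (𝓞 K) K)) = 1 := by
  rw [sphericalWeight_apply, map_one, map_one, bump_hsQ_defect_one, if_pos (one_mem _), mul_one]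

/-- **`η` IS BI-`K_GL`-INVARIANT**: `η(κ₁ g κ₂) = η(g)` for `κ₁, κ₂ ∈ K_GL = K_∞·GL_n(𝒪̂_K)` (★ `mem_standardMaximalCompactGL_iff_toMixed_sndHom`: `(κᵢ)_∞ ∈ K_∞`, `(κᵢ)_f ∈ GL_n(𝒪̂_K)`; §2
`bump_hsQ_defect_mul_mul`). [cite: MoeglinWaldspurger1995, II.1.2] [cite: Knapp1986, Ch. I §1] -/
theorem sphericalWeight_mul_mul {κ₁ κ₂ : GL (Fin n) (AdeleRing (𝓞 K) K)} (hκ₁ : κ₁ ∈ standardMaximalCompactGL n K) (hκ₂ : κ₂ ∈ standardMaximalCompactGL n K)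
    (g : GL (Fin n) (AdeleRing (𝓞 K) K)) :
    adelicWeight (glFiniteIntegralLevel n K) (fun x : GL (Fin n) (mixedSpace K) => φ (hsQ ((x : Matrix (Fin n) (Fin n) (mixedSpace K))ᴴ - ((x⁻¹ : GL (Fin n) (mixedSpace K)) : Matrix (Fin n) (Fin n) (mixedSpace K))))) (κ₁ * g * κ₂) =
      adelicWeight (glFiniteIntegralLevel n K) (fun x : GL (Fin n) (mixedSpace K) => φ (hsQ ((x : Matrix (Fin n) (Fin n) (mixedSpace K))ᴴ - ((x⁻¹ : GL (Fin n) (mixedSpace K)) : Matrix (Fin n) (Fin n) (mixedSpace K))))) g := by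
  obtain ⟨h₁i, h₁f⟩ := (mem_standardMaximalCompactGL_iff_toMixed_sndHom κ₁).1 hκ₁
  obtain ⟨h₂i, h₂f⟩ := (mem_standardMaximalCompactGL_iff_toMixed_sndHom κ₂).1 hκ₂
  rw [sphericalWeight_apply, sphericalWeight_apply, map_mul, map_mul, map_mul, map_mul, bump_hsQ_defect_mul_mul φ h₁i h₂i]
  congr 1
  have hiff : GLn.sndHom n K κ₁ * GLn.sndHom n K g * GLn.sndHom n K κ₂ ∈ glFiniteIntegralLevel n K ↔ GLn.sndHom n K g ∈ glFiniteIntegralLevel n K := by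
    rw [Subgroup.mul_mem_cancel_right _ h₂f, Subgroup.mul_mem_cancel_left _ h₁f]
  simp only [hiff]

end Adelic

/-! ## §4 (ED. 2, dealer K2E1-plan (g5) 09:25:54Z «ONE EXTRA HEAD») Inversion symmetry: `D(x⁻¹) = D(x)` and `η(g⁻¹) = η(g)` -/

section Symmetric

variable {n : ℕ} {K : Type} [Field K] [NumberField K]

/-- `Q(zᴴ) = Q(z)` (`Re tr(z zᴴ) = Re tr(zᴴ z)`). [cite: Knapp1986, Ch. I §1] -/
theorem hsQ_conjTranspose (z : Matrix (Fin n) (Fin n) (mixedSpace K)) : hsQ zᴴ = hsQ z := by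
  unfold hsQ
  rw [Matrix.conjTranspose_conjTranspose, Matrix.trace_mul_comm]

/-- `Q(−z) = Q(z)`. [folklore] -/
theorem hsQ_neg (z : Matrix (Fin n) (Fin n) (mixedSpace K)) : hsQ (-z) = hsQ z := by
  rw [← neg_one_smul ℝ z, hsQ_smul]
  ring

/-- **THE DEFECT IS INVERSION-SYMMETRIC**: `Q((x⁻¹)ᴴ − (x⁻¹)⁻¹) = Q(xᴴ − x⁻¹)` (`(x⁻¹)ᴴ − x = −(xᴴ − x⁻¹)ᴴ`, `Q(−zᴴ) = Q(z)`). [cite: Knapp1986, Ch. I §1] -/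
theorem hsQ_defect_inv (x : GL (Fin n) (mixedSpace K)) :
    hsQ (((x⁻¹ : GL (Fin n) (mixedSpace K)) : Matrix (Fin n) (Fin n) (mixedSpace K))ᴴ - (((x⁻¹)⁻¹ : GL (Fin n) (mixedSpace K)) : Matrix (Fin n) (Fin n) (mixedSpace K))) = hsQ ((x : Matrix (Fin n) (Fin n) (mixedSpace K))ᴴ - ((x⁻¹ : GL (Fin n) (mixedSpace K)) : Matrix (Fin n) (Fin n) (mixedSpace K))) := by
  rw [inv_inv, show ((x⁻¹ : GL (Fin n) (mixedSpace K)) : Matrix (Fin n) (Fin n) (mixedSpace K))ᴴ - (x : Matrix (Fin n) (Fin n) (mixedSpace K)) = -((x : Matrix (Fin n) (Fin n) (mixedSpace K))ᴴ - ((x⁻¹ : GL (Fin n) (mixedSpace K)) : Matrix (Fin n) (Fin n) (mixedSpace K)))ᴴ by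
    rw [Matrix.conjTranspose_sub, Matrix.conjTranspose_conjTranspose, neg_sub], hsQ_neg, hsQ_conjTranspose]

variable (φ : ContDiffBump (0 : ℝ))

/-- **`η(g⁻¹) = η(g)`**: the spherical test function is SYMMETRIC under inversion (`D(g_∞⁻¹) = D(g_∞)`, §4 `hsQ_defect_inv`; `g_f⁻¹ ∈ GL_n(𝒪̂_K) ⟺ g_f ∈ GL_n(𝒪̂_K)`) — so the test functions of
record `h = η ∗ η = η^∨ ∗ η` are symmetric, `h(g⁻¹) = h(g)`, as the self-adjointness of `δ(h)` (P6′) wants. [cite: MoeglinWaldspurger1995, II.1.2] [cite: Knapp1986, Ch. I §1] -/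
theorem sphericalWeight_inv (g : GL (Fin n) (AdeleRing (𝓞 K) K)) :
    adelicWeight (glFiniteIntegralLevel n K) (fun x : GL (Fin n) (mixedSpace K) => φ (hsQ ((x : Matrix (Fin n) (Fin n) (mixedSpace K))ᴴ - ((x⁻¹ : GL (Fin n) (mixedSpace K)) : Matrix (Fin n) (Fin n) (mixedSpace K))))) (g⁻¹ : GL (Fin n) (AdeleRing (𝓞 K) K)) = adelicWeight (glFiniteIntegralLevel n K) (fun x : GL (Fin n) (mixedSpace K) => φ (hsQ ((x : Matrix (Fin n) (Fin n) (mixedSpace K))ᴴ - ((x⁻¹ : GL (Fin n) (mixedSpace K)) : Matrix (Fin n) (Fin n) (mixedSpace K))))) g := by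
  rw [sphericalWeight_apply, sphericalWeight_apply, map_inv, map_inv, hsQ_defect_inv]
  congr 1
  simp only [Subgroup.inv_mem_iff]

end Symmetric

end Summit.HodgeConjecture.HodgeConjecture.Cruxes.H413.K2E1SphericalTestFunctionGL

end
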